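import Summits.Ventures.LatticeQCDFlow.Scaling.GroundStateIdentities

/-!
HONEST FRAMING: exact (Metropolis-corrected) sampling algorithms for lattice gauge theory; figures
of merit are autocorrelation/cost numbers at stated couplings and volumes; no continuum-physics
claim.

# GroundStatePoincare — A POINCARÉ INEQUALITY `Σ_kv_k² ≤ a·Σ_r(v_{i_r} − v_{l_r})² + b·v_0²` IS A FLOOR ON THE RATE: `min{t/(a·m), h/b} ≤ ρ`; THE PATH (`a = K(K+1)`, `b = 2(K+1)`)
# AND THE HUB-ADJACENT LISTS (every cold level listed with the hot one: `a = 2`, `b = 2K+1`) (lean-2 GEN-48, ours)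

Venture-side (OURS).  Cell `lqcd-flow` (pub-lqcd), unit `pub-lqcd-lean-2-g48`, 2026-08-31.  Chapter AI (the sizes of the Robin ground state), file 3 — Mathlib only (through file 1).
File 1's energy identity `ρΣc² = (t/m)Σ_r(c_{i_r} − c_{l_r})² + hc_0²` turns any Poincaré inequality for the list — `Σ_kv_k² ≤ a·Σ_r(v_{i_r} − v_{l_r})² + b·v_0²` for all `v` — into
`Σc² ≤ max{am/t, b/h}·ρΣc²`, i.e. **`1 ≤ ρ·max{am/t, b/h}`, `min{t/(am), h/b} ≤ ρ`** (§1).  Two Poincaré inequalities are typed: (§2) THE PATH `0 ~ 1 ~ ⋯ ~ K` by telescoping and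
Cauchy–Schwarz, `v_k² ≤ 2v_0² + 2k·Σ_{j<K}(v_{j+1} − v_j)²`, summed: `Σ_kv_k² ≤ K(K+1)·Σ_{j<K}(v_{j+1} − v_j)² + 2(K+1)·v_0²` (stated for `ℕ`-indexed vectors and for `Fin (K+1)`), so a
positive solution on the adjacent list `e_j = (j, j+1)` (`m = K`) has **`min{t/(K²(K+1)), h/(2(K+1))} ≤ ρ`** — chapter AG file 5's `min{t/(K(2K+1)²), 2√2h/(π²(K+1))}` by cosines, here
from the vertex equations alone and with better constants; (§3) HUB-ADJACENT LISTS — if every cold level is listed with the hot one at least once (the star with a hot hub, the complete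
list, any list containing the hot star): `v_k² ≤ 2v_0² + 2(v_k − v_0)²` gives `Σ_kv_k² ≤ 2·Σ_r(v_{i_r} − v_{l_r})² + (2K+1)·v_0²`, so **`min{t/(2m), h/(2K+1)} ≤ ρ`** (star with `c`-fold hub
edges, `m = cK`: `t/(2cK)`; complete list, `m = cK(K+1)/2`: `t/(cK(K+1))` — chapter AH files 3 and 10's orders, law-free of their explicit two-value vectors).  No definitions; no Markov chain
in this file.

* §1 `groundState_one_le_rho_mul_max`, `groundState_rho_ge_min`; §2 `path_poincare_nat`, `path_poincare_fin`, `pathList_rho_ge`; §3 `hubAdjacent_poincare`, `hubAdjacent_rho_ge`.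

Literature grade (cell rule): ELEMENTARY (canonical-path Poincaré inequalities, Diaconis–Stroock ∕ Sinclair style, for the grounded Dirichlet form of a swap list), NEW TYPING; nothing
cited; no new bib keys.
-/

noncomputable section

open Finset

namespace Summit.Ventures.LatticeQCDFlow.Scaling

section Poincare
variable {K m : ℕ} (e : Fin m → Fin (K + 1) × Fin (K + 1)) {t h ρ : ℝ} {c : Fin (K + 1) → ℝ}

/-! ## §1 A Poincaré inequality is a floor on the rate -/

/-- **`1 ≤ ρ·max{am/t, b/h}` from a Poincaré inequality `Σv² ≤ aΣ_r(v_{i_r} − v_{l_r})² + bv_0²`** (positive solution, `m ≥ 1`, `t, h > 0`). [ours] -/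
theorem groundState_one_le_rho_mul_max (hm : 1 ≤ m) (ht : 0 < t) (hh : 0 < h) (hc : ∀ k, 0 < c k)
    (hvertex : ∀ k : Fin (K + 1), t / m * ∑ r : Fin m, ((if k = (e r).1 then c (e r).2 - c (e r).1 else 0) + (if k = (e r).2 then c (e r).1 - c (e r).2 else 0))
      - (if k = 0 then h * c k else 0) = -ρ * c k)
    {a b : ℝ}
    (hP : ∀ v : Fin (K + 1) → ℝ, ∑ k : Fin (K + 1), v k ^ 2 ≤ a * ∑ r : Fin m, (v (e r).1 - v (e r).2) ^ 2 + b * v 0 ^ 2) :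
    1 ≤ ρ * max (a * m / t) (b / h) := by
  have hmpos : (0 : ℝ) < m := Nat.cast_pos.mpr (by omega)
  have hS : 0 < ∑ k : Fin (K + 1), c k ^ 2 := by
    have : c 0 ^ 2 ≤ ∑ k : Fin (K + 1), c k ^ 2 := Finset.single_le_sum (fun k _ => sq_nonneg (c k)) (mem_univ 0)
    nlinarith [hc 0]
  have hen := groundState_energy e hvertex
  have hPc := hP c
  set M : ℝ := max (a * m / t) (b / h) with hM
  set X : ℝ := ∑ r : Fin m, (c (e r).1 - c (e r).2) ^ 2 with hX
  have hX0 : 0 ≤ X := sum_nonneg fun r _ => sq_nonneg _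
  have h1 : a * X ≤ M * (t / m * X) := by
    have : a * X = (a * m / t) * (t / m * X) := by field_simp
    rw [this]
    exact mul_le_mul_of_nonneg_right (le_max_left _ _) (by positivity)
  have h2 : b * c 0 ^ 2 ≤ M * (h * c 0 ^ 2) := by
    have : b * c 0 ^ 2 = (b / h) * (h * c 0 ^ 2) := by field_simp
    rw [this]
    exact mul_le_mul_of_nonneg_right (le_max_right _ _) (by positivity)
  have h3 : ∑ k : Fin (K + 1), c k ^ 2 ≤ M * (ρ * ∑ k : Fin (K + 1), c k ^ 2) := by
    rw [hen, mul_add]; linarith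
  by_contra hlt
  push Not at hlt
  have : M * ρ < 1 := by rw [mul_comm]; exact hlt
  nlinarith

/-- **THE RATE FLOOR `min{t/(am), h/b} ≤ ρ` from a Poincaré inequality** (`a, b > 0`). [ours] -/
theorem groundState_rho_ge_min (hm : 1 ≤ m) (ht : 0 < t) (hh : 0 < h) (hc : ∀ k, 0 < c k)
    (hvertex : ∀ k : Fin (K + 1), t / m * ∑ r : Fin m, ((if k = (e r).1 then c (e r).2 - c (e r).1 else 0) + (if k = (e r).2 then c (e r).1 - c (e r).2 else 0))
      - (if k = 0 then h * c k else 0) = -ρ * c k)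
    {a b : ℝ} (ha : 0 < a) (hb : 0 < b)
    (hP : ∀ v : Fin (K + 1) → ℝ, ∑ k : Fin (K + 1), v k ^ 2 ≤ a * ∑ r : Fin m, (v (e r).1 - v (e r).2) ^ 2 + b * v 0 ^ 2) :
    min (t / (a * m)) (h / b) ≤ ρ := by
  have hmpos : (0 : ℝ) < m := Nat.cast_pos.mpr (by omega)
  have h1 := groundState_one_le_rho_mul_max e hm ht hh hc hvertex hP
  rcases le_total (a * m / t) (b / h) with hle | hle
  · rw [max_eq_right hle] at h1
    have : h / b ≤ ρ := by
      rw [div_le_iff₀ hb]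
      have := mul_le_mul_of_nonneg_left h1 hh.le
      calc h = h * 1 := (mul_one h).symm
        _ ≤ h * (ρ * (b / h)) := this
        _ = ρ * b := by field_simp
    exact le_trans (min_le_right _ _) this
  · rw [max_eq_left hle] at h1
    have : t / (a * m) ≤ ρ := by
      rw [div_le_iff₀ (by positivity)]
      have := mul_le_mul_of_nonneg_left h1 ht.le
      calc t = t * 1 := (mul_one t).symm
        _ ≤ t * (ρ * (a * m / t)) := this
        _ = ρ * (a * m) := by field_simp
    exact le_trans (min_le_left _ _) this

/-! ## §2 The path -/

omit e in
/-- **THE PATH'S POINCARÉ INEQUALITY (`ℕ`-indexed):** `Σ_{k≤K}v_k² ≤ K(K+1)·Σ_{j<K}(v_{j+1} − v_j)² + 2(K+1)·v_0²`. [ours] -/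
theorem path_poincare_nat (K : ℕ) (v : ℕ → ℝ) :
    ∑ k ∈ range (K + 1), v k ^ 2 ≤ (K : ℝ) * (K + 1) * ∑ j ∈ range K, (v (j + 1) - v j) ^ 2 + 2 * ((K : ℝ) + 1) * v 0 ^ 2 := by
  have hD0 : 0 ≤ ∑ j ∈ range K, (v (j + 1) - v j) ^ 2 := sum_nonneg fun j _ => sq_nonneg _
  -- pointwise: `v_k² ≤ 2v_0² + 2k·D` for `k ≤ K`
  have hpt : ∀ k ∈ range (K + 1), v k ^ 2 ≤ 2 * v 0 ^ 2 + 2 * (k : ℝ) * ∑ j ∈ range K, (v (j + 1) - v j) ^ 2 := by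
    intro k hk
    have hkK : k ≤ K := Nat.lt_succ_iff.mp (mem_range.mp hk)
    have htel : ∑ j ∈ range k, (v (j + 1) - v j) = v k - v 0 := sum_range_sub v k
    have hcs : (∑ j ∈ range k, (v (j + 1) - v j)) ^ 2 ≤ (k : ℝ) * ∑ j ∈ range k, (v (j + 1) - v j) ^ 2 := by
      have := sq_sum_le_card_mul_sum_sq (s := range k) (f := fun j => v (j + 1) - v j)
      rw [card_range] at this
      exact_mod_cast this
    have hmono : ∑ j ∈ range k, (v (j + 1) - v j) ^ 2 ≤ ∑ j ∈ range K, (v (j + 1) - v j) ^ 2 :=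
      sum_le_sum_of_subset_of_nonneg (fun x hx => mem_range.mpr (lt_of_lt_of_le (mem_range.mp hx) hkK)) fun j _ _ => sq_nonneg _
    have hk0 : (0 : ℝ) ≤ k := Nat.cast_nonneg k
    rw [htel] at hcs
    nlinarith [sq_nonneg (v k - v 0 + v 0), sq_nonneg (v k - v 0 - v 0), mul_le_mul_of_nonneg_left hmono hk0]
  have hsum := sum_le_sum hpt
  rw [sum_add_distrib, sum_const, card_range, nsmul_eq_mul] at hsum
  have hk : ∑ k ∈ range (K + 1), 2 * (k : ℝ) * ∑ j ∈ range K, (v (j + 1) - v j) ^ 2 = (K : ℝ) * (K + 1) * ∑ j ∈ range K, (v (j + 1) - v j) ^ 2 := by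
    rw [← sum_mul, ← mul_sum]
    have : ∑ k ∈ range (K + 1), (k : ℝ) = (K : ℝ) * (K + 1) / 2 := by
      have h2 := sum_range_id_mul_two (K + 1)
      have h3 : ((∑ i ∈ range (K + 1), i : ℕ) : ℝ) * 2 = ((K + 1) * (K + 1 - 1) : ℕ) := by exact_mod_cast h2
      push_cast at h3
      linarith [h3]
    rw [this]; ring
  rw [hk] at hsum
  push_cast at hsum
  linarith

omit e in
/-- **THE PATH'S POINCARÉ INEQUALITY on `Fin (K+1)`:** `Σ_kv_k² ≤ K(K+1)·Σ_{j : Fin K}(v_{j} − v_{j+1})² + 2(K+1)·v_0²` (edges `(j.castSucc, j.succ)`). [ours] -/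
theorem path_poincare_fin (v : Fin (K + 1) → ℝ) :
    ∑ k : Fin (K + 1), v k ^ 2 ≤ (K : ℝ) * (K + 1) * ∑ j : Fin K, (v j.castSucc - v j.succ) ^ 2 + 2 * ((K : ℝ) + 1) * v 0 ^ 2 := by
  set w : ℕ → ℝ := fun n => if hn : n < K + 1 then v ⟨n, hn⟩ else 0 with hw
  have hwk : ∀ k : Fin (K + 1), w k = v k := fun k => by rw [hw]; simp only [dif_pos k.2, Fin.eta]
  have h1 : ∑ k : Fin (K + 1), v k ^ 2 = ∑ k ∈ range (K + 1), w k ^ 2 := by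
    rw [← Fin.sum_univ_eq_sum_range (fun n => w n ^ 2) (K + 1)]
    exact sum_congr rfl fun k _ => by rw [hwk]
  have h2 : ∑ j : Fin K, (v j.castSucc - v j.succ) ^ 2 = ∑ j ∈ range K, (w (j + 1) - w j) ^ 2 := by
    rw [← Fin.sum_univ_eq_sum_range (fun n => (w (n + 1) - w n) ^ 2) K]
    refine sum_congr rfl fun j _ => ?_
    have ha : w ((j : ℕ) + 1) = v j.succ := by
      have := hwk j.succ; rw [Fin.val_succ] at this; exact this
    have hb : w (j : ℕ) = v j.castSucc := by
      have := hwk j.castSucc; rw [Fin.val_castSucc] at this; exact this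
    rw [ha, hb]; ring
  have h0 : w 0 = v 0 := by have := hwk 0; rw [Fin.val_zero] at this; exact this
  rw [h1, h2, ← h0]
  exact path_poincare_nat K w

/-- **THE ADJACENT LIST'S RATE FLOOR: `min{t/(K²(K+1)), h/(2(K+1))} ≤ ρ`** for a positive solution on `e_j = (j, j+1)`, `j < K` (`m = K ≥ 1`, `t, h > 0`). [ours] -/
theorem pathList_rho_ge (hK : 1 ≤ K) (ht : 0 < t) (hh : 0 < h) {eK : Fin K → Fin (K + 1) × Fin (K + 1)} (heK : ∀ j : Fin K, eK j = (j.castSucc, j.succ))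
    (hc : ∀ k, 0 < c k)
    (hvertex : ∀ k : Fin (K + 1), t / K * ∑ r : Fin K, ((if k = (eK r).1 then c (eK r).2 - c (eK r).1 else 0) + (if k = (eK r).2 then c (eK r).1 - c (eK r).2 else 0))
      - (if k = 0 then h * c k else 0) = -ρ * c k) :
    min (t / ((K : ℝ) ^ 2 * (K + 1))) (h / (2 * ((K : ℝ) + 1))) ≤ ρ := by
  have hKpos : (0 : ℝ) < K := Nat.cast_pos.mpr (by omega)
  have hP : ∀ v : Fin (K + 1) → ℝ, ∑ k : Fin (K + 1), v k ^ 2 ≤ (K : ℝ) * (K + 1) * ∑ r : Fin K, (v (eK r).1 - v (eK r).2) ^ 2 + 2 * ((K : ℝ) + 1) * v 0 ^ 2 := by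
    intro v
    have := path_poincare_fin v
    simp_rw [heK]
    exact this
  have h := groundState_rho_ge_min eK hK ht hh hc hvertex (a := (K : ℝ) * (K + 1)) (b := 2 * ((K : ℝ) + 1)) (by positivity) (by positivity) hP
  have heq : t / ((K : ℝ) * (K + 1) * K) = t / ((K : ℝ) ^ 2 * (K + 1)) := by ring_nf
  rw [heq] at h
  exact h

/-! ## §3 Hub-adjacent lists -/

omit e in
/-- **THE HUB-ADJACENT POINCARÉ INEQUALITY:** if every cold level `k ≠ 0` is listed with the hot one (some `r` with `{i_r, l_r} = {0, k}`), then
`Σ_kv_k² ≤ 2·Σ_r(v_{i_r} − v_{l_r})² + (2K+1)·v_0²`. [ours] -/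
theorem hubAdjacent_poincare (e : Fin m → Fin (K + 1) × Fin (K + 1))
    (hadj : ∀ k : Fin (K + 1), k ≠ 0 → ∃ r : Fin m, ((e r).1 = 0 ∧ (e r).2 = k) ∨ ((e r).1 = k ∧ (e r).2 = 0)) (v : Fin (K + 1) → ℝ) :
    ∑ k : Fin (K + 1), v k ^ 2 ≤ 2 * ∑ r : Fin m, (v (e r).1 - v (e r).2) ^ 2 + (2 * (K : ℝ) + 1) * v 0 ^ 2 := by
  classical
  -- a hub edge for every cold level `i.succ`
  have hex : ∀ i : Fin K, ∃ r : Fin m, ((e r).1 = 0 ∧ (e r).2 = i.succ) ∨ ((e r).1 = i.succ ∧ (e r).2 = 0) := fun i => hadj i.succ (Fin.succ_ne_zero i)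
  choose rr hrr using hex
  have hinj : Function.Injective rr := by
    intro i j hij
    have hi := hrr i
    have hj := hrr j
    rw [hij] at hi
    have : (i.succ : Fin (K + 1)) = j.succ := by
      rcases hi with ⟨h1, h2⟩ | ⟨h1, h2⟩ <;> rcases hj with ⟨h3, h4⟩ | ⟨h3, h4⟩
      · rw [← h2, h4]
      · exfalso; exact Fin.succ_ne_zero j (h3.symm.trans h1)
      · exfalso; exact Fin.succ_ne_zero j (h4.symm.trans h2)
      · rw [← h1, h3]
    exact Fin.succ_injective _ this
  -- the cold levels' squares
  have hpt : ∀ i : Fin K, v i.succ ^ 2 ≤ 2 * v 0 ^ 2 + 2 * (v (e (rr i)).1 - v (e (rr i)).2) ^ 2 := by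
    intro i
    have hsq : (v (e (rr i)).1 - v (e (rr i)).2) ^ 2 = (v i.succ - v 0) ^ 2 := by
      rcases hrr i with ⟨h1, h2⟩ | ⟨h1, h2⟩
      · rw [h1, h2]; ring
      · rw [h1, h2]
    rw [hsq]
    nlinarith [sq_nonneg (v i.succ - 2 * v 0)]
  have hsub : ∑ i : Fin K, (v (e (rr i)).1 - v (e (rr i)).2) ^ 2 ≤ ∑ r : Fin m, (v (e r).1 - v (e r).2) ^ 2 := by
    have : ∑ i : Fin K, (v (e (rr i)).1 - v (e (rr i)).2) ^ 2 = ∑ r ∈ univ.map ⟨rr, hinj⟩, (v (e r).1 - v (e r).2) ^ 2 := by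
      rw [sum_map]; rfl
    rw [this]
    exact sum_le_univ_sum_of_nonneg fun r => sq_nonneg _
  rw [Fin.sum_univ_succ]
  have hcold := sum_le_sum fun i (_ : i ∈ univ) => hpt i
  rw [sum_add_distrib, sum_const, card_univ, Fintype.card_fin, nsmul_eq_mul, ← mul_sum] at hcold
  nlinarith [hcold, hsub, sq_nonneg (v 0)]

/-- **THE HUB-ADJACENT RATE FLOOR: `min{t/(2m), h/(2K+1)} ≤ ρ`** for a positive solution on a list in which every cold level is listed with the hot one (`m ≥ 1`, `t, h > 0`) — the star
with `c`-fold hub edges (`m = cK`) and the complete list (`m = cK(K+1)/2`) included. [ours] -/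
theorem hubAdjacent_rho_ge (hm : 1 ≤ m) (ht : 0 < t) (hh : 0 < h)
    (hadj : ∀ k : Fin (K + 1), k ≠ 0 → ∃ r : Fin m, ((e r).1 = 0 ∧ (e r).2 = k) ∨ ((e r).1 = k ∧ (e r).2 = 0)) (hc : ∀ k, 0 < c k)
    (hvertex : ∀ k : Fin (K + 1), t / m * ∑ r : Fin m, ((if k = (e r).1 then c (e r).2 - c (e r).1 else 0) + (if k = (e r).2 then c (e r).1 - c (e r).2 else 0))
      - (if k = 0 then h * c k else 0) = -ρ * c k) :
    min (t / (2 * (m : ℝ))) (h / (2 * (K : ℝ) + 1)) ≤ ρ := by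
  have h := groundState_rho_ge_min e hm ht hh hc hvertex (a := 2) (b := 2 * (K : ℝ) + 1) (by norm_num) (by positivity) (hubAdjacent_poincare e hadj)
  exact h

end Poincare

end Summit.Ventures.LatticeQCDFlow.Scaling

end
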